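import Mathlib
import Summits.ValiantsHypothesis.ValiantsHypothesis.Theorems.BarrierLeverPartitionMinorsHitByVPHiddenStatesBall

/-!
# Route BarrierLever — item `PartitionMinorsHitByVP` (stmt-ValiantsHypothesis-19717):
# the hidden-state door with up to `h³` states (size exponent `b = 8`)

Helper file (`--supports stmt-ValiantsHypothesis-19717`; cell valiant-natproofs, rung V4, 𝒟-side of door (c); prover seat
val-np-p3 gen 7). Definition-free. Closes NO item.

Why: the seat's STAR / BICLIQUE obstruction (`…HiddenStatesStar.not_ballGood_star6`, memo HOME/val-np-p3/g7 §8) shows that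
Conjecture Q\* (`BallGood h K r u` for all injective `u`) needs `K ≳ h²/11` hidden states for large `h`; the landed doors stop at
`K ≤ h·h` (`partitionMinor_hit_of_hiddenStates_mem`, `partitionMinorsHitByVP_of_ballGood'`, `b = 6`), a constant factor above the
bound. This file re-derives the size estimate for `K ≤ h·h·h` (`b = 8`), so that the conjecture of record can be taken at
`K(h) = h³` with a polynomial safety margin:

* `partitionMinor_hit_of_hiddenStates_mem_cube` — the door with `K ≤ h³`, `h ≥ 5`, inside `SmallCircuits ℂ (h+h) 8`;
* `partitionMinorsHitByVP_of_ballGood_cube` — item 19717 (with `b = 8`) from `BallGood h (Kf h) r u` for all injective `u`,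
  all `h ≥ h₁`, ONE state count `Kf h ∈ [h, h³]` per `h`.

WHAT THIS IS NOT: no family is proved good here; Q\* at any `K` is open beyond the affinely independent regime; nothing on CPM,
crux 14610 or VP ≠ VNP.
-/

set_option linter.dupNamespace false

namespace Summit.ValiantsHypothesis.ValiantsHypothesis.Theorems.BarrierLever.HiddenStates

open Finset Matrix
open Literature.Barriers.ValiantsHypothesis

noncomputable section

/-- **The hidden-state door with `K ≤ h³` states** (`h ≥ 5`): the witness lies in `SmallCircuits ℂ (h+h) 8`. -/
theorem partitionMinor_hit_of_hiddenStates_mem_cube (h K r : ℕ) (hh : 5 ≤ h) (hK : K ≤ h * h * h)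
    (u w : Fin r → Finset (Fin h))
    (e : Fin r → Finset (Fin K)) (he : Function.Injective e) (wt : Fin K → ℕ)
    (hthr : ∀ J : Finset (Fin K), J ∉ Set.range e → ∀ i, ∑ k ∈ e i, wt k < ∑ k ∈ J, wt k)
    (tx ty : Option (Fin K) → Fin h → ℂ)
    (hx : (Matrix.of fun i k : Fin r => ∏ a ∈ u i, (tx none a + ∑ q ∈ e k, tx (some q) a)).det ≠ 0)
    (hy : (Matrix.of fun j k : Fin r => ∏ c ∈ w j, (ty none c + ∑ q ∈ e k, ty (some q) c)).det ≠ 0) :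
    ∃ f ∈ SmallCircuits ℂ (h + h) 8,
      (Matrix.of fun i j : Fin r => MvPolynomial.coeff
        (∑ a ∈ u i, Finsupp.single (Fin.castAdd h a) 1 +
          ∑ c ∈ w j, Finsupp.single (Fin.natAdd h c) 1) f).det ≠ 0 := by
  obtain ⟨f, hdeg, hsize, hf⟩ := partitionMinor_hit_of_hiddenStates h K r u w e he wt hthr tx ty hx hy
  refine ⟨f, ⟨hdeg, hsize.trans ?_⟩, hf⟩
  have e1 : h + h + 2 ≤ 3 * h := by omega
  have e2 : 3 * (h + h) + (K * (3 * (h + h) + 2) + K) + 1 ≤ 8 * (h * h * h * h) := by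
    have h1 : K * (3 * (h + h) + 2) + K ≤ h * h * h * (3 * (h + h) + 2) + h * h * h := by gcongr
    have h2 : 3 * (h + h) + 2 + 1 ≤ 8 * h := by omega
    nlinarith
  have e3 : h + h + 1 ≤ h * h * h * h * h * h * h * h := by
    have e3a : h + h + 1 ≤ h * h := by nlinarith
    calc h + h + 1 ≤ h * h := e3a
      _ ≤ h * h * (h * h * h * h * h * h) := Nat.le_mul_of_pos_right _ (by positivity)
      _ = h * h * h * h * h * h * h * h := by ring
  calc (h + h + 2) ^ 2 * (3 * (h + h) + (K * (3 * (h + h) + 2) + K) + 1) + (h + h + 1)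
      ≤ (3 * h) ^ 2 * (8 * (h * h * h * h)) + h * h * h * h * h * h * h * h := by gcongr
    _ = 72 * (h * h * h * h * h * h) + h * h * h * h * h * h * h * h := by ring
    _ ≤ (h + h) ^ 8 := by
        have : (h + h) ^ 8 = 256 * (h * h * h * h * h * h * h * h) := by ring
        rw [this]
        have key : 72 * (h * h * h * h * h * h) ≤ 72 * (h * h * h * h * h * h * h * h) := by
          have : h * h * h * h * h * h ≤ h * h * h * h * h * h * (h * h) :=
            Nat.le_mul_of_pos_right _ (by positivity)
          calc 72 * (h * h * h * h * h * h) ≤ 72 * (h * h * h * h * h * h * (h * h)) := by gcongr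
            _ = 72 * (h * h * h * h * h * h * h * h) := by ring
        linarith

/-- **Item 19717 modulo Conjecture Q\* with up to `h³` hidden states.** If for all `h ≥ h₁` there is ONE state count
`Kf h ∈ [h, h³]` such that every injective family is `BallGood h (Kf h) r`, then `PartitionMinorsHitByVP` (size exponent `b = 8`). -/
theorem partitionMinorsHitByVP_of_ballGood_cube (h₁ : ℕ) (Kf : ℕ → ℕ)
    (hK : ∀ h : ℕ, h₁ ≤ h → h ≤ Kf h ∧ Kf h ≤ h * h * h)
    (H : ∀ h : ℕ, h₁ ≤ h → ∀ (r : ℕ) (u : Fin r → Finset (Fin h)), Function.Injective u →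
      BallGood h (Kf h) r u) :
    Summit.ValiantsHypothesis.ValiantsHypothesis.Theses.BarrierLever.PartitionMinorsHitByVP := by
  refine ⟨8, max h₁ 5, fun h hh r u w hu hw => ?_⟩
  have hh₁ : h₁ ≤ h := le_trans (le_max_left _ _) hh
  have hh5 : 5 ≤ h := le_trans (le_max_right _ _) hh
  obtain ⟨hKlo, hKhi⟩ := hK h hh₁
  have hr : r ≤ 2 ^ Kf h := by
    have := Fintype.card_le_of_injective u hu
    rw [Fintype.card_fin, Fintype.card_finset, Fintype.card_fin] at this
    exact this.trans (Nat.pow_le_pow_right (by norm_num) hKlo)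
  obtain ⟨e, he, hthr⟩ := exists_ballColex (Kf h) r hr
  obtain ⟨tx, hx⟩ := H h hh₁ r u hu e he hthr
  obtain ⟨ty, hy⟩ := H h hh₁ r w hw e he hthr
  exact partitionMinor_hit_of_hiddenStates_mem_cube h (Kf h) r hh5 hKhi u w e he (ballWt (Kf h)) hthr tx ty hx hy

end

end Summit.ValiantsHypothesis.ValiantsHypothesis.Theorems.BarrierLever.HiddenStates
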